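import Summits.HodgeConjecture.HodgeConjecture.Theorems.F0P3cStCharTSShellTracePSH    -- ★ p849597 F1-H `smoothTrace_cmPrincipalSeriesH_indicator_shell_eq_ite` (flexible dominant `b`); brings ★ kit p849282 (`doubleCoset_prod`, `charDist_indicator_of_forall_eq`, …)
import Summits.HodgeConjecture.HodgeConjecture.Theorems.F0P3cStCharTSHSt                -- ★ p847858 «HSt» `steinbergLabel_smoothTrace_eq` (`Tr πSt = Tr i_H(χ_H) − χ_ξ`)
import Summits.HodgeConjecture.HodgeConjecture.Theorems.F0P3cStCharTSXiOnTorus          -- ★ p849803 (this seat) `xiLocalChar_eq_psi_mul_rootDeltaChar_mul_weyl` (`ξ_v|_{T_H} = ψdet·δ^{1∕2}·wχ_H`)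
import Literature.NumberTheory.Automorphic.JacquetRayShellTrace                          -- ★ p848022 `bijOn_mul_transversal` (`#(K b K ∕ K) = #R`)
import Literature.NumberTheory.Automorphic.HeckeOperatorAdjoint                          -- ★ `measure_doubleCoset_eq_ncard_mul` (`μ(K b K) = #(KbK∕K)·μ(K)`)
import HarnessLib

/-!
# F0 · P3c · line LH6 «StCharTS» — road (D) «DEEP-FL», (D-c)(δ) «ST-SHELL-TRACE»: the character of the Steinberg label `St_H(ξ_v)` on the `H`-shell
# `𝟙_{K_H (b, z₁) K_H}` at a FLEXIBLE dominant torus point `b ∈ T₂` — `Tr St_H(ξ_v)(𝟙_{K_H (b,z₁) K_H}) = ν₂(K_{2,n})·#R₂·ν₁(K₁)·ψ_v(det z₁)·δ_{B₂}^{1∕2}(b)·χ_{H,2}(b)`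
# [Rogawski1990, §12.1 case (1) pp. 171–172; §12.7 L. 12.7.3 p. 195] [Casselman1977, Thm. 5.2] [Casselman1995, L. 7.1.1 (a)]

Cell `pub/hodgecm-mathlib`, crux H413 = `stmt-HodgeConjecture-24833` (lane `--supports … --as helper`), route HCCMUnconditional; seat LH6-p02 (g2); road (D) owner
LH6-p04 (g3), ROAD-D v7 `F0/P3b/LH6-p04/g3/ROAD-D.status.v7.txt` (7d68ee66) «(δ) ST-SHELL-TRACE + (δ₄) LH6-p02», owner «=» 2026-09-02T06:27:56Z (2); census
`F0/P3b/LH6-p02/g2/CENSUS-VALUE-IDENTITY.v1.md` §2a.  THEOREMS ONLY, sorry-free, ★-only imports; no definition ∕ instance ∕ notation ∕ named fact.  HONEST LABEL: HC_CM is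
proved only modulo the 7 printed citations (2 remaining: hLiu418 = stmt-HodgeConjecture-24832, h413 = stmt-HodgeConjecture-24833) until rung 0 closes; count-neutral (D-c) input,
closes nothing by itself.

THE MATHEMATICS.  `H_v = U(Φ₂)(L⁺_v) × U(Φ₁)(L⁺_v)`, `χ_H = χ_{H,2} ⊠ ψ_v∘det` the label character of the organs (`χ_{H,2} = (η̃_v·‖·‖^{1∕2}, ψ_v)` on `T₂`), `JH(i_H(χ_H)) =
{π₁ = ξ_v, πSt = St_H(ξ_v)}` (★ `HLengthTwoLabels`).  For a shell `K_H (b, z₁) K_H`, `K_H = K_{2,n} × K₁`, at a torus point `b ∈ T₂` DOMINANT at level `n` in the sense of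
★ F1-H (`hbN`, `hbNbar`, `hbexh`; NOT only `z₂·𝓘₂.aᵐ` — this is what the (δ) coset representatives `u_j = b·s_j` need, (Q2) of the census), with `K_H ≤ ker ξ_v`, `K₁ ≤
ker ψ_v∘det` and `χ_{H,2}` trivial on `K_{2,n} ∩ T₂` (deep level):
  `Tr πSt(𝟙) = Tr i_H(χ_H)(𝟙) − ξ_v(𝟙)`                                   (★ HSt `steinbergLabel_smoothTrace_eq`)
  `Tr i_H(χ_H)(𝟙) = ν₂(K_{2,n})·#R₂·ν₁(K₁)·ψdet(z₁)·δ^{1∕2}(b)·(χ_{H,2}(b) + wχ_{H,2}(b))`   (★ F1-H, Jacquet datum of `i₂(χ_{H,2})` BY SHAPE with line character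
      `wχ_{H,2} = weylTorusCharPair … 0 (η̃·‖·‖^{1∕2}) ψ` — LH5-p05's ★ W2-c `u2PrincipalSeries_jacquetFiltration` discharges `hfd h2 ℓ hℓ1 hL hQ`)
  `ξ_v(𝟙) = ν_H(K_H (b,z₁) K_H)·ξ_v(b, z₁) = ν₂(K_{2,n})·#R₂·ν₁(K₁)·ψdet(z₁)·δ^{1∕2}(b)·wχ_{H,2}(b)`   (★ kit `charDist_indicator_of_forall_eq`; `ν₂(K b K) = #R₂·ν₂(K)` by
      ★ `measure_doubleCoset_eq_ncard_mul` + ★ `bijOn_mul_transversal`; ★ p849803 `ξ_v|_{T_H} = ψdet·δ^{1∕2}·wχ_H`)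
so the `wχ_H`-terms cancel: **`steinbergLabel_smoothTrace_shell_eq_exponent`** — `= A_H(b, z₁)·Θ(b, z₁)` of the census (`A_H = ν₂(K_{2,n})·#R₂·ν₁(K₁)·δ^{1∕2}(b)`,
`Θ = χ_{H,2} ⊠ ψdet`), the per-summand input of ★ p849817 `sum_coeff_mul_trace_eq_value` ∕ of the XIG-ASSEMBLY VALUE clause `hVAL` (LH6-p04 (g3)).

## References
* [Rogawski1990] J. D. Rogawski, *Automorphic Representations of Unitary Groups in Three Variables*, Ann. of Math. Stud. 123 (1990): §12.1 case (1) pp. 171–172;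
  §12.7 p. 193, Lemma 12.7.3 p. 195; §4.9 Prop. 4.9.1 p. 55.
* [Casselman1977] W. Casselman, *Characters and Jacquet modules*, Math. Ann. 230 (1977), Thm. 5.2.
* [Casselman1995] W. Casselman, *Introduction to the theory of admissible representations of p-adic reductive groups* (1995), §1.5 Lemma 1.5.1, §3.3, §4.1, Lemma 7.1.1 (a).
* [BushnellHenniart2006] C. J. Bushnell, G. Henniart, *The Local Langlands Conjecture for GL(2)*, Grundlehren 335 (2006), §4.1.
-/

set_option autoImplicit false
-- the mandated namespace has the single-problem summit's repeated segment (`HodgeConjecture.HodgeConjecture`)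
set_option linter.dupNamespace false

noncomputable section

open NumberField IsDedekindDomain MeasureTheory Topology
open scoped Matrix MatrixGroups Pointwise
open Literature.NumberTheory Literature.NumberTheory.Automorphic Literature.NumberTheory.Automorphic.UnitaryGroup
open Literature.NumberTheory.GaloisRepresentations
open Literature.NumberTheory.Rogawski1990

namespace Summit.HodgeConjecture.HodgeConjecture.Cruxes.H413.F0P3cStCharTSStShellTrace

open Summit.HodgeConjecture.HodgeConjecture.Cruxes.H413.F0P3cStCharTSCassHTraceKit

/-! ## §1 Generic: `μ(K b K) = #R · μ(K)` for a left transversal `R` of `K ∕ (K ∩ bKb⁻¹)` -/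

section Generic

variable {G : Type*} [Group G] [TopologicalSpace G] [IsTopologicalGroup G] [MeasurableSpace G] [BorelSpace G]

/-- **`μ(K b K) = #R · μ(K)`** for `K` an open subgroup, `μ` left-invariant and `R` a left transversal of `K ∕ (K ∩ bKb⁻¹)`: `K b K = ⨆_{r ∈ R} r b K` (★
`bijOn_mul_transversal`: `r ↦ (rb)K` is a bijection `R ≃ K·(bK)`, ★ `measure_doubleCoset_eq_ncard_mul`). [cite: Casselman1995, §1.5 Lemma 1.5.1] [cite: BushnellHenniart2006, §4.1] -/
theorem measureReal_doubleCoset_eq_card_mul (μ : Measure G) [μ.IsMulLeftInvariant] {K : Subgroup G} (hKo : IsOpen (K : Set G)) (b : G)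
    {R : Finset G} (hR : IsLeftTransversal K (K ⊓ ConjAct.toConjAct b • K) R) :
    μ.real (DoubleCoset.doubleCoset b (K : Set G) K) = (R.card : ℝ) * μ.real (K : Set G) := by
  classical
  have hbij := Representation.bijOn_mul_transversal b hR
  have hfin : (MulAction.orbit K (b : G ⧸ K)).Finite := hbij.finite_iff_finite.1 (Finset.finite_toSet _)
  have hn : (MulAction.orbit K (b : G ⧸ K)).ncard = R.card := by
    rw [← hbij.ncard_eq, Set.ncard_coe_finset, Finset.card_image_of_injective _ (mul_left_injective b)]
  rw [measureReal_def, measure_doubleCoset_eq_ncard_mul K μ hKo b hfin, hn, ENNReal.toReal_mul, ENNReal.toReal_natCast, measureReal_def]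

end Generic


/-! ## §2 The CM instance: `Tr St_H(ξ_v)` on the shell `K_H (b, z₁) K_H` at a flexible dominant `b ∈ T₂` -/

section CM

variable (L : Type) [Field L] [NumberField L] [IsCMField L] (v : HeightOneSpectrum (𝓞 ↥(maximalRealSubfield L)))
  [MeasurableSpace ((cmDatum L 2 (Matrix.of fun i j : Fin 2 => if i.val + j.val + 1 = 2 then (1 : L) else 0)).Local v)] [BorelSpace ((cmDatum L 2 (Matrix.of fun i j : Fin 2 => if i.val + j.val + 1 = 2 then (1 : L) else 0)).Local v)] [MeasurableSpace ((cmDatum L 1 (Matrix.of fun i j : Fin 1 => if i.val + j.val + 1 = 1 then (1 : L) else 0)).Local v)] [BorelSpace ((cmDatum L 1 (Matrix.of fun i j : Fin 1 => if i.val + j.val + 1 = 1 then (1 : L) else 0)).Local v)]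

open scoped Classical in
set_option maxHeartbeats 4000000 in  -- statement-level `whnf` on the CM carriers (measured class, ★ F1-H ∕ ★ (D-b))
set_option synthInstance.maxHeartbeats 400000 in
/-- **(δ) «ST-SHELL-TRACE»: `Tr St_H(ξ_v)(𝟙_{K_H (b,z₁) K_H}) = ν₂(K_{2,n})·#R₂·(ν₁(K₁)·ψ_v(det z₁))·δ_{B₂}^{1∕2}(b)·χ_{H,2}(b)`** on `H_v = U(Φ₂)(L⁺_v) × U(Φ₁)(L⁺_v)`
(Haar measure `ν₂ ⊗ ν₁`), for the Steinberg label `πSt` of ★ `HLengthTwoLabels` (with `π₁ = ξ_v` as a distribution, `hπ₁`), an Iwahori datum `𝓘₂` of `B₂`, a level `n`,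
a torus point `b ∈ T₂` DOMINANT at level `n` in the sense of ★ F1-H (`hbN`, `hbNbar`, `hbexh` — any such `b`, not only `z₂·𝓘₂.aᵐ`), a left transversal `R₂` of
`K_{2,n} ∕ (K_{2,n} ∩ bK_{2,n}b⁻¹)`, a compact open `K₁ ≤ ker(ψ_v∘det)` of `U(Φ₁)(L⁺_v)` (`hK₁χ`; `ψ_v∘det` with open kernel, `hψo`), `z₁ ∈ U(Φ₁)(L⁺_v)`, the level
deep: `K_H = K_{2,n} × K₁ ≤ ker ξ_v` (`hlev`) and `χ_{H,2}` trivial on `K_{2,n} ∩ T₂` (`hχlev`), GIVEN the normalised 2-step Jacquet datum of `i₂(χ_{H,2})` BY SHAPE with line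
character `wχ_{H,2}` (`hfd h2 ℓ hℓ1 hL hQ`; = LH5-p05's ★ W2-c `u2PrincipalSeries_jacquetFiltration`) and `hiff` (F1-H's binders verbatim).  Proof: ★ HSt − ★ F1-H − the
`χ_ξ`-term `ν_H(K_H (b,z₁) K_H)·ξ_v(b,z₁)` with `ν₂(K_{2,n} b K_{2,n}) = #R₂·ν₂(K_{2,n})` (§1) and `ξ_v(b,z₁) = ψdet(z₁)·δ^{1∕2}(b)·wχ_{H,2}(b)` (★ p849803): the
`wχ_{H,2}`-terms cancel.  (= `A_H(b,z₁)·Θ(b,z₁)` of the census, the per-summand input of ★ p849817 ∕ XIG-ASSEMBLY's `hVAL`.)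
[cite: Rogawski1990, §12.1 case (1) pp. 171–172; §12.7 Lemma 12.7.3 p. 195] [cite: Casselman1977, Thm. 5.2] [cite: Casselman1995, §1.5 Lemma 1.5.1, Lemma 7.1.1 (a)] -/
theorem steinbergLabel_smoothTrace_shell_eq_exponent
    (hns : ∀ w : PlacesOver L v, IsCMField.complexConj L • w.1 = w.1)
    (ν₂ : Measure ((cmDatum L 2 (Matrix.of fun i j : Fin 2 => if i.val + j.val + 1 = 2 then (1 : L) else 0)).Local v)) [ν₂.IsHaarMeasure] [ν₂.IsMulRightInvariant]
    (ν₁ : Measure ((cmDatum L 1 (Matrix.of fun i j : Fin 1 => if i.val + j.val + 1 = 1 then (1 : L) else 0)).Local v)) [ν₁.IsHaarMeasure] [ν₁.IsMulRightInvariant]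
    (ξ : OneDimAutRepH L) (π₁ πSt : IrrClass (((cmDatum L 2 (Matrix.of fun i j : Fin 2 => if i.val + j.val + 1 = 2 then (1 : L) else 0)).Local v) × ((cmDatum L 1 (Matrix.of fun i j : Fin 1 => if i.val + j.val + 1 = 1 then (1 : L) else 0)).Local v)))
    (hlab : HLengthTwoLabels L v
      (torusCharPair (conjLocal L (IsCMField.complexConj L) v) (cmLocalForm L 2 v) (cmLocalForm_eq_over L 2 v) 0
            ((torusLocalComponent L (IsCMField.complexConj L) v ξ.η).comp
                (quotConj (conjLocal L (IsCMField.complexConj L) v) (conjLocal_conjLocal_cm L v)) *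
              halfModulusChar (UnitaryGroup.LocalRing L v))
            (torusLocalComponent L (IsCMField.complexConj L) v ξ.ψ))
      ((torusLocalComponent L (IsCMField.complexConj L) v ξ.ψ).comp (localDet (IsCMField.complexConj L) v (isUnit_antidiagOne_det L 1))) π₁ πSt)
    (hπ₁ : ∀ fH : ((cmDatum L 2 (Matrix.of fun i j : Fin 2 => if i.val + j.val + 1 = 2 then (1 : L) else 0)).Local v) × ((cmDatum L 1 (Matrix.of fun i j : Fin 1 => if i.val + j.val + 1 = 1 then (1 : L) else 0)).Local v) → ℂ, IsLocSmooth fH → π₁.smoothTrace (ν₂.prod ν₁) fH = charDist (ξ.xiLocalChar v) (ν₂.prod ν₁) fH)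
    (hψo : IsOpen (SetLike.coe (MonoidHom.ker ((torusLocalComponent L (IsCMField.complexConj L) v ξ.ψ).comp (localDet (IsCMField.complexConj L) v (isUnit_antidiagOne_det L 1))))))
    (𝓘₂ : (cmBorelTriple L 2 v).IwahoriDatum) (n : ℕ)
    {b : ↥(unitaryGroupOfForm (conjLocal L (IsCMField.complexConj L) v) (cmLocalForm L 2 v))} (hbM : b ∈ (cmBorelTriple L 2 v).M)
    (hbN : ∀ x ∈ 𝓘₂.K n ⊓ (cmBorelTriple L 2 v).N, b * x * b⁻¹ ∈ 𝓘₂.K n)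
    (hbNbar : ∀ x ∈ 𝓘₂.K n ⊓ 𝓘₂.Nbar, b⁻¹ * x * b ∈ 𝓘₂.K n ⊓ 𝓘₂.Nbar)
    (hbexh : ∀ x ∈ (cmBorelTriple L 2 v).N, ∃ m : ℕ, ∀ m', m ≤ m' → b ^ m' * x * (b ^ m')⁻¹ ∈ 𝓘₂.K n)
    {R₂ : Finset ↥(unitaryGroupOfForm (conjLocal L (IsCMField.complexConj L) v) (cmLocalForm L 2 v))} (hR₂ : IsLeftTransversal (𝓘₂.K n) (𝓘₂.K n ⊓ ConjAct.toConjAct b • 𝓘₂.K n) R₂)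
    (K₁ : Subgroup ((cmDatum L 1 (Matrix.of fun i j : Fin 1 => if i.val + j.val + 1 = 1 then (1 : L) else 0)).Local v)) (hK₁o : IsOpen (K₁ : Set ((cmDatum L 1 (Matrix.of fun i j : Fin 1 => if i.val + j.val + 1 = 1 then (1 : L) else 0)).Local v))) (hK₁c : IsCompact (K₁ : Set ((cmDatum L 1 (Matrix.of fun i j : Fin 1 => if i.val + j.val + 1 = 1 then (1 : L) else 0)).Local v)))
    (hK₁χ : ∀ k ∈ K₁, ((torusLocalComponent L (IsCMField.complexConj L) v ξ.ψ).comp (localDet (IsCMField.complexConj L) v (isUnit_antidiagOne_det L 1))) k = 1)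
    (z₁ : ((cmDatum L 1 (Matrix.of fun i j : Fin 1 => if i.val + j.val + 1 = 1 then (1 : L) else 0)).Local v))
    (hlev : ∀ x ∈ ((𝓘₂.K n).prod K₁ : Subgroup (↥(unitaryGroupOfForm (conjLocal L (IsCMField.complexConj L) v) (cmLocalForm L 2 v)) × ((cmDatum L 1 (Matrix.of fun i j : Fin 1 => if i.val + j.val + 1 = 1 then (1 : L) else 0)).Local v))), ξ.xiLocalChar v x = 1)
    (hχlev : ∀ k : ↥(cmBorelTriple L 2 v).M, (k : ↥(unitaryGroupOfForm (conjLocal L (IsCMField.complexConj L) v) (cmLocalForm L 2 v))) ∈ 𝓘₂.K n →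
      (torusCharPair (conjLocal L (IsCMField.complexConj L) v) (cmLocalForm L 2 v) (cmLocalForm_eq_over L 2 v) 0
            ((torusLocalComponent L (IsCMField.complexConj L) v ξ.η).comp
                (quotConj (conjLocal L (IsCMField.complexConj L) v) (conjLocal_conjLocal_cm L v)) *
              halfModulusChar (UnitaryGroup.LocalRing L v))
            (torusLocalComponent L (IsCMField.complexConj L) v ξ.ψ)) k = 1) :
    haveI := locallyCompactSpace_cmBorelU L 2 v
    ∀ (hfd : FiniteDimensional ℂ ((cmBorelTriple L 2 v).restrict (cmPrincipalSeries L 2 v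
          (torusCharPair (conjLocal L (IsCMField.complexConj L) v) (cmLocalForm L 2 v) (cmLocalForm_eq_over L 2 v) 0
            ((torusLocalComponent L (IsCMField.complexConj L) v ξ.η).comp
                (quotConj (conjLocal L (IsCMField.complexConj L) v) (conjLocal_conjLocal_cm L v)) *
              halfModulusChar (UnitaryGroup.LocalRing L v))
            (torusLocalComponent L (IsCMField.complexConj L) v ξ.ψ)))).Coinvariants)
      (h2 : Module.finrank ℂ ((cmBorelTriple L 2 v).restrict (cmPrincipalSeries L 2 v
          (torusCharPair (conjLocal L (IsCMField.complexConj L) v) (cmLocalForm L 2 v) (cmLocalForm_eq_over L 2 v) 0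
            ((torusLocalComponent L (IsCMField.complexConj L) v ξ.η).comp
                (quotConj (conjLocal L (IsCMField.complexConj L) v) (conjLocal_conjLocal_cm L v)) *
              halfModulusChar (UnitaryGroup.LocalRing L v))
            (torusLocalComponent L (IsCMField.complexConj L) v ξ.ψ)))).Coinvariants = 2)
      (ℓ : Submodule ℂ ((cmBorelTriple L 2 v).restrict (cmPrincipalSeries L 2 v
          (torusCharPair (conjLocal L (IsCMField.complexConj L) v) (cmLocalForm L 2 v) (cmLocalForm_eq_over L 2 v) 0
            ((torusLocalComponent L (IsCMField.complexConj L) v ξ.η).comp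
                (quotConj (conjLocal L (IsCMField.complexConj L) v) (conjLocal_conjLocal_cm L v)) *
              halfModulusChar (UnitaryGroup.LocalRing L v))
            (torusLocalComponent L (IsCMField.complexConj L) v ξ.ψ)))).Coinvariants) (hℓ1 : Module.finrank ℂ ℓ = 1)
      (hL : ∀ (m : ↥(cmBorelTriple L 2 v).M), ∀ x ∈ ℓ, (cmPrincipalSeries L 2 v
          (torusCharPair (conjLocal L (IsCMField.complexConj L) v) (cmLocalForm L 2 v) (cmLocalForm_eq_over L 2 v) 0
            ((torusLocalComponent L (IsCMField.complexConj L) v ξ.η).comp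
                (quotConj (conjLocal L (IsCMField.complexConj L) v) (conjLocal_conjLocal_cm L v)) *
              halfModulusChar (UnitaryGroup.LocalRing L v))
            (torusLocalComponent L (IsCMField.complexConj L) v ξ.ψ))).normalizedJacquet (cmBorelTriple L 2 v) m x =
          (((weylTorusCharPair (conjLocal L (IsCMField.complexConj L) v) (cmLocalForm L 2 v) (cmLocalForm_eq_over L 2 v) 0
            ((torusLocalComponent L (IsCMField.complexConj L) v ξ.η).comp
                (quotConj (conjLocal L (IsCMField.complexConj L) v) (conjLocal_conjLocal_cm L v)) *
              halfModulusChar (UnitaryGroup.LocalRing L v))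
            (torusLocalComponent L (IsCMField.complexConj L) v ξ.ψ)) m : ℂˣ) : ℂ) • x)
      (hQ : ∀ (m : ↥(cmBorelTriple L 2 v).M) (x : ((cmBorelTriple L 2 v).restrict (cmPrincipalSeries L 2 v
          (torusCharPair (conjLocal L (IsCMField.complexConj L) v) (cmLocalForm L 2 v) (cmLocalForm_eq_over L 2 v) 0
            ((torusLocalComponent L (IsCMField.complexConj L) v ξ.η).comp
                (quotConj (conjLocal L (IsCMField.complexConj L) v) (conjLocal_conjLocal_cm L v)) *
              halfModulusChar (UnitaryGroup.LocalRing L v))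
            (torusLocalComponent L (IsCMField.complexConj L) v ξ.ψ)))).Coinvariants),
        (cmPrincipalSeries L 2 v (torusCharPair (conjLocal L (IsCMField.complexConj L) v) (cmLocalForm L 2 v) (cmLocalForm_eq_over L 2 v) 0
            ((torusLocalComponent L (IsCMField.complexConj L) v ξ.η).comp
                (quotConj (conjLocal L (IsCMField.complexConj L) v) (conjLocal_conjLocal_cm L v)) *
              halfModulusChar (UnitaryGroup.LocalRing L v))
            (torusLocalComponent L (IsCMField.complexConj L) v ξ.ψ))).normalizedJacquet (cmBorelTriple L 2 v) m x -
          (((torusCharPair (conjLocal L (IsCMField.complexConj L) v) (cmLocalForm L 2 v) (cmLocalForm_eq_over L 2 v) 0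
            ((torusLocalComponent L (IsCMField.complexConj L) v ξ.η).comp
                (quotConj (conjLocal L (IsCMField.complexConj L) v) (conjLocal_conjLocal_cm L v)) *
              halfModulusChar (UnitaryGroup.LocalRing L v))
            (torusLocalComponent L (IsCMField.complexConj L) v ξ.ψ)) m : ℂˣ) : ℂ) • x ∈ ℓ)
      (hiff : (∀ k : ↥(cmBorelTriple L 2 v).M, (k : ↥(unitaryGroupOfForm (conjLocal L (IsCMField.complexConj L) v) (cmLocalForm L 2 v))) ∈ 𝓘₂.K n → (torusCharPair (conjLocal L (IsCMField.complexConj L) v) (cmLocalForm L 2 v) (cmLocalForm_eq_over L 2 v) 0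
            ((torusLocalComponent L (IsCMField.complexConj L) v ξ.η).comp
                (quotConj (conjLocal L (IsCMField.complexConj L) v) (conjLocal_conjLocal_cm L v)) *
              halfModulusChar (UnitaryGroup.LocalRing L v))
            (torusLocalComponent L (IsCMField.complexConj L) v ξ.ψ)) k = 1) ↔
        (∀ k : ↥(cmBorelTriple L 2 v).M, (k : ↥(unitaryGroupOfForm (conjLocal L (IsCMField.complexConj L) v) (cmLocalForm L 2 v))) ∈ 𝓘₂.K n → (weylTorusCharPair (conjLocal L (IsCMField.complexConj L) v) (cmLocalForm L 2 v) (cmLocalForm_eq_over L 2 v) 0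
            ((torusLocalComponent L (IsCMField.complexConj L) v ξ.η).comp
                (quotConj (conjLocal L (IsCMField.complexConj L) v) (conjLocal_conjLocal_cm L v)) *
              halfModulusChar (UnitaryGroup.LocalRing L v))
            (torusLocalComponent L (IsCMField.complexConj L) v ξ.ψ)) k = 1)),
    πSt.smoothTrace (ν₂.prod ν₁) (((DoubleCoset.doubleCoset ((b, z₁) : ↥(unitaryGroupOfForm (conjLocal L (IsCMField.complexConj L) v) (cmLocalForm L 2 v)) × ((cmDatum L 1 (Matrix.of fun i j : Fin 1 => if i.val + j.val + 1 = 1 then (1 : L) else 0)).Local v)) (((𝓘₂.K n).prod K₁ : Subgroup (↥(unitaryGroupOfForm (conjLocal L (IsCMField.complexConj L) v) (cmLocalForm L 2 v)) × ((cmDatum L 1 (Matrix.of fun i j : Fin 1 => if i.val + j.val + 1 = 1 then (1 : L) else 0)).Local v))) : Set (↥(unitaryGroupOfForm (conjLocal L (IsCMField.complexConj L) v) (cmLocalForm L 2 v)) × ((cmDatum L 1 (Matrix.of fun i j : Fin 1 => if i.val + j.val + 1 = 1 then (1 : L) else 0)).Local v))) (((𝓘₂.K n).prod K₁ : Subgroup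 (↥(unitaryGroupOfForm (conjLocal L (IsCMField.complexConj L) v) (cmLocalForm L 2 v)) × ((cmDatum L 1 (Matrix.of fun i j : Fin 1 => if i.val + j.val + 1 = 1 then (1 : L) else 0)).Local v))) : Set (↥(unitaryGroupOfForm (conjLocal L (IsCMField.complexConj L) v) (cmLocalForm L 2 v)) × ((cmDatum L 1 (Matrix.of fun i j : Fin 1 => if i.val + j.val + 1 = 1 then (1 : L) else 0)).Local v))))).indicator fun _ => (1 : ℂ)) =
      (ν₂.real (𝓘₂.K n : Set ↥(unitaryGroupOfForm (conjLocal L (IsCMField.complexConj L) v) (cmLocalForm L 2 v))) : ℂ) * (R₂.card : ℂ) *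
        ((ν₁.real (K₁ : Set ((cmDatum L 1 (Matrix.of fun i j : Fin 1 => if i.val + j.val + 1 = 1 then (1 : L) else 0)).Local v)) : ℂ) * ((((torusLocalComponent L (IsCMField.complexConj L) v ξ.ψ).comp (localDet (IsCMField.complexConj L) v (isUnit_antidiagOne_det L 1))) z₁ : ℂˣ) : ℂ)) *
        ((rootDeltaChar (cmBorelTriple L 2 v).P (Subgroup.inclusion (cmBorelTriple L 2 v).M_le ⟨b, hbM⟩) : ℂˣ) : ℂ) *
        (((torusCharPair (conjLocal L (IsCMField.complexConj L) v) (cmLocalForm L 2 v) (cmLocalForm_eq_over L 2 v) 0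
            ((torusLocalComponent L (IsCMField.complexConj L) v ξ.η).comp
                (quotConj (conjLocal L (IsCMField.complexConj L) v) (conjLocal_conjLocal_cm L v)) *
              halfModulusChar (UnitaryGroup.LocalRing L v))
            (torusLocalComponent L (IsCMField.complexConj L) v ξ.ψ)) ⟨b, hbM⟩ : ℂˣ) : ℂ) := by
  intro hfd h2 ℓ hℓ1 hL hQ hiff
  haveI := locallyCompactSpace_cmBorelU L 2 v
  -- §0 instances: the `U(Φ₂)`-factor in its `unitaryGroupOfForm` spelling, and `U(Φ₁)_v` (verbatim ★ (D-b))
  letI iM2 : MeasurableSpace ↥(unitaryGroupOfForm (conjLocal L (IsCMField.complexConj L) v) (cmLocalForm L 2 v)) := ‹MeasurableSpace ((cmDatum L 2 (Matrix.of fun i j : Fin 2 => if i.val + j.val + 1 = 2 then (1 : L) else 0)).Local v)›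
  haveI iB2 : BorelSpace ↥(unitaryGroupOfForm (conjLocal L (IsCMField.complexConj L) v) (cmLocalForm L 2 v)) := ‹BorelSpace ((cmDatum L 2 (Matrix.of fun i j : Fin 2 => if i.val + j.val + 1 = 2 then (1 : L) else 0)).Local v)›
  haveI : LocallyCompactSpace ↥(unitaryGroupOfForm (conjLocal L (IsCMField.complexConj L) v) (cmLocalForm L 2 v)) := locallyCompactSpace_local (IsCMField.complexConj L) 2 _ v
  haveI : SecondCountableTopology ↥(unitaryGroupOfForm (conjLocal L (IsCMField.complexConj L) v) (cmLocalForm L 2 v)) := secondCountableTopology_local (IsCMField.complexConj L) 2 _ v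
  haveI : T2Space ↥(unitaryGroupOfForm (conjLocal L (IsCMField.complexConj L) v) (cmLocalForm L 2 v)) := t2Space_cmDatum_local 2 L (Matrix.of fun i j : Fin 2 => if i.val + j.val + 1 = 2 then (1 : L) else 0) v
  haveI := nonarchimedeanGroup_cmLocal L 2 v
  haveI : NonarchimedeanGroup ((cmDatum L 1 (Matrix.of fun i j : Fin 1 => if i.val + j.val + 1 = 1 then (1 : L) else 0)).Local v) := nonarchimedeanGroup_cmLocal L 1 v
  haveI iH2 : @MeasureTheory.Measure.IsHaarMeasure ↥(unitaryGroupOfForm (conjLocal L (IsCMField.complexConj L) v) (cmLocalForm L 2 v)) _ _ iM2 ν₂ := ‹ν₂.IsHaarMeasure›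
  haveI : SigmaCompactSpace ↥(unitaryGroupOfForm (conjLocal L (IsCMField.complexConj L) v) (cmLocalForm L 2 v)) := sigmaCompactSpace_of_locallyCompact_secondCountable
  haveI : SigmaCompactSpace ((cmDatum L 1 (Matrix.of fun i j : Fin 1 => if i.val + j.val + 1 = 1 then (1 : L) else 0)).Local v) := sigmaCompactSpace_of_locallyCompact_secondCountable
  haveI : SigmaCompactSpace ((cmDatum L 2 (Matrix.of fun i j : Fin 2 => if i.val + j.val + 1 = 2 then (1 : L) else 0)).Local v) := sigmaCompactSpace_of_locallyCompact_secondCountable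
  -- §1 the shell is compact open, its indicator is a smooth test function
  have hKHo : IsOpen (((𝓘₂.K n).prod K₁ : Subgroup (↥(unitaryGroupOfForm (conjLocal L (IsCMField.complexConj L) v) (cmLocalForm L 2 v)) × ((cmDatum L 1 (Matrix.of fun i j : Fin 1 => if i.val + j.val + 1 = 1 then (1 : L) else 0)).Local v))) : Set (↥(unitaryGroupOfForm (conjLocal L (IsCMField.complexConj L) v) (cmLocalForm L 2 v)) × ((cmDatum L 1 (Matrix.of fun i j : Fin 1 => if i.val + j.val + 1 = 1 then (1 : L) else 0)).Local v))) := (𝓘₂.isOpen_K n).prod hK₁o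
  have hKHc : IsCompact (((𝓘₂.K n).prod K₁ : Subgroup (↥(unitaryGroupOfForm (conjLocal L (IsCMField.complexConj L) v) (cmLocalForm L 2 v)) × ((cmDatum L 1 (Matrix.of fun i j : Fin 1 => if i.val + j.val + 1 = 1 then (1 : L) else 0)).Local v))) : Set (↥(unitaryGroupOfForm (conjLocal L (IsCMField.complexConj L) v) (cmLocalForm L 2 v)) × ((cmDatum L 1 (Matrix.of fun i j : Fin 1 => if i.val + j.val + 1 = 1 then (1 : L) else 0)).Local v))) := (𝓘₂.isCompact_K n).prod hK₁c
  have hSo : IsOpen (DoubleCoset.doubleCoset ((b, z₁) : ↥(unitaryGroupOfForm (conjLocal L (IsCMField.complexConj L) v) (cmLocalForm L 2 v)) × ((cmDatum L 1 (Matrix.of fun i j : Fin 1 => if i.val + j.val + 1 = 1 then (1 : L) else 0)).Local v)) (((𝓘₂.K n).prod K₁ : Subgroup (↥(unitaryGroupOfForm (conjLocal L (IsCMField.complexConj L) v) (cmLocalForm L 2 v)) × ((cmDatum L 1 (Matrix.of fun i j : Fin 1 => if i.val + j.val + 1 = 1 then (1 : L) else 0)).Local v))) : Set (↥(unitaryGroupOfForm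 (conjLocal L (IsCMField.complexConj L) v) (cmLocalForm L 2 v)) × ((cmDatum L 1 (Matrix.of fun i j : Fin 1 => if i.val + j.val + 1 = 1 then (1 : L) else 0)).Local v))) (((𝓘₂.K n).prod K₁ : Subgroup (↥(unitaryGroupOfForm (conjLocal L (IsCMField.complexConj L) v) (cmLocalForm L 2 v)) × ((cmDatum L 1 (Matrix.of fun i j : Fin 1 => if i.val + j.val + 1 = 1 then (1 : L) else 0)).Local v))) : Set (↥(unitaryGroupOfForm (conjLocal L (IsCMField.complexConj L) v) (cmLocalForm L 2 v)) × ((cmDatum L 1 (Matrix.of fun i j : Fin 1 => if i.val + j.val + 1 = 1 then (1 : L) else 0)).Local v)))) := by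
    unfold DoubleCoset.doubleCoset; exact hKHo.mul_left
  have hSc : IsCompact (DoubleCoset.doubleCoset ((b, z₁) : ↥(unitaryGroupOfForm (conjLocal L (IsCMField.complexConj L) v) (cmLocalForm L 2 v)) × ((cmDatum L 1 (Matrix.of fun i j : Fin 1 => if i.val + j.val + 1 = 1 then (1 : L) else 0)).Local v)) (((𝓘₂.K n).prod K₁ : Subgroup (↥(unitaryGroupOfForm (conjLocal L (IsCMField.complexConj L) v) (cmLocalForm L 2 v)) × ((cmDatum L 1 (Matrix.of fun i j : Fin 1 => if i.val + j.val + 1 = 1 then (1 : L) else 0)).Local v))) : Set (↥(unitaryGroupOfForm (conjLocal L (IsCMField.complexConj L) v) (cmLocalForm L 2 v)) × ((cmDatum L 1 (Matrix.of fun i j : Fin 1 => if i.val + j.val + 1 = 1 then (1 : L) else 0)).Local v))) (((𝓘₂.K n).prod K₁ : Subgroup (↥(unitaryGroupOfForm (conjLocal L (IsCMField.complexConj L) v) (cmLocalForm L 2 v)) × ((cmDatum L 1 (Matrix.of fun i j : Fin 1 => if i.val + j.val + 1 = 1 then (1 : L) else 0)).Local v))) : Set (↥(unitaryGroupOfForm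 (conjLocal L (IsCMField.complexConj L) v) (cmLocalForm L 2 v)) × ((cmDatum L 1 (Matrix.of fun i j : Fin 1 => if i.val + j.val + 1 = 1 then (1 : L) else 0)).Local v)))) :=
    (hKHc.mul isCompact_singleton).mul hKHc
  have hfH : IsLocSmooth (((DoubleCoset.doubleCoset ((b, z₁) : ↥(unitaryGroupOfForm (conjLocal L (IsCMField.complexConj L) v) (cmLocalForm L 2 v)) × ((cmDatum L 1 (Matrix.of fun i j : Fin 1 => if i.val + j.val + 1 = 1 then (1 : L) else 0)).Local v)) (((𝓘₂.K n).prod K₁ : Subgroup (↥(unitaryGroupOfForm (conjLocal L (IsCMField.complexConj L) v) (cmLocalForm L 2 v)) × ((cmDatum L 1 (Matrix.of fun i j : Fin 1 => if i.val + j.val + 1 = 1 then (1 : L) else 0)).Local v))) : Set (↥(unitaryGroupOfForm (conjLocal L (IsCMField.complexConj L) v) (cmLocalForm L 2 v)) × ((cmDatum L 1 (Matrix.of fun i j : Fin 1 => if i.val + j.val + 1 = 1 then (1 : L) else 0)).Local v))) (((𝓘₂.K n).prod K₁ : Subgroup (↥(unitaryGroupOfForm (conjLocal L (IsCMField.complexConj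 L) v) (cmLocalForm L 2 v)) × ((cmDatum L 1 (Matrix.of fun i j : Fin 1 => if i.val + j.val + 1 = 1 then (1 : L) else 0)).Local v))) : Set (↥(unitaryGroupOfForm (conjLocal L (IsCMField.complexConj L) v) (cmLocalForm L 2 v)) × ((cmDatum L 1 (Matrix.of fun i j : Fin 1 => if i.val + j.val + 1 = 1 then (1 : L) else 0)).Local v))))).indicator fun _ => (1 : ℂ)) := isLocSmooth_indicator hSo hSc.isClosed hSc
  -- §2 ★ HSt: `Tr πSt = Tr i_H(χ_H) − χ_ξ`; the first term is ★ F1-H (stated in the HSt spelling, proved by unification — the `cmDatum`∕`«local»` carriers agree definitionally)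
  rw [F0P3cStCharTSHSt.steinbergLabel_smoothTrace_eq L v (ν₂.prod ν₁) ξ hns π₁ πSt hlab hπ₁ _ hfH]
  have e₁ : Representation.smoothTrace (cmPrincipalSeriesH L v
          (torusCharPair (conjLocal L (IsCMField.complexConj L) v) (cmLocalForm L 2 v) (cmLocalForm_eq_over L 2 v) 0
            ((torusLocalComponent L (IsCMField.complexConj L) v ξ.η).comp
                (quotConj (conjLocal L (IsCMField.complexConj L) v) (conjLocal_conjLocal_cm L v)) *
              halfModulusChar (UnitaryGroup.LocalRing L v))
            (torusLocalComponent L (IsCMField.complexConj L) v ξ.ψ))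
          ((torusLocalComponent L (IsCMField.complexConj L) v ξ.ψ).comp (localDet (IsCMField.complexConj L) v (isUnit_antidiagOne_det L 1)))) (ν₂.prod ν₁)
        (((DoubleCoset.doubleCoset ((b, z₁) : ↥(unitaryGroupOfForm (conjLocal L (IsCMField.complexConj L) v) (cmLocalForm L 2 v)) × ((cmDatum L 1 (Matrix.of fun i j : Fin 1 => if i.val + j.val + 1 = 1 then (1 : L) else 0)).Local v)) (((𝓘₂.K n).prod K₁ : Subgroup (↥(unitaryGroupOfForm (conjLocal L (IsCMField.complexConj L) v) (cmLocalForm L 2 v)) × ((cmDatum L 1 (Matrix.of fun i j : Fin 1 => if i.val + j.val + 1 = 1 then (1 : L) else 0)).Local v))) : Set (↥(unitaryGroupOfForm (conjLocal L (IsCMField.complexConj L) v) (cmLocalForm L 2 v)) × ((cmDatum L 1 (Matrix.of fun i j : Fin 1 => if i.val + j.val + 1 = 1 then (1 : L) else 0)).Local v))) (((𝓘₂.K n).prod K₁ : Subgroup (↥(unitaryGroupOfForm (conjLocal L (IsCMField.complexConj L) v) (cmLocalForm L 2 v)) × ((cmDatum L 1 (Matrix.of fun i j : Fin 1 => if i.val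 + j.val + 1 = 1 then (1 : L) else 0)).Local v))) : Set (↥(unitaryGroupOfForm (conjLocal L (IsCMField.complexConj L) v) (cmLocalForm L 2 v)) × ((cmDatum L 1 (Matrix.of fun i j : Fin 1 => if i.val + j.val + 1 = 1 then (1 : L) else 0)).Local v))))).indicator fun _ => (1 : ℂ)) =
      (ν₂.real (𝓘₂.K n : Set ↥(unitaryGroupOfForm (conjLocal L (IsCMField.complexConj L) v) (cmLocalForm L 2 v))) : ℂ) * (R₂.card : ℂ) *
        (if (∀ k : ↥(cmBorelTriple L 2 v).M, (k : ↥(unitaryGroupOfForm (conjLocal L (IsCMField.complexConj L) v) (cmLocalForm L 2 v))) ∈ 𝓘₂.K n → (torusCharPair (conjLocal L (IsCMField.complexConj L) v) (cmLocalForm L 2 v) (cmLocalForm_eq_over L 2 v) 0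
            ((torusLocalComponent L (IsCMField.complexConj L) v ξ.η).comp
                (quotConj (conjLocal L (IsCMField.complexConj L) v) (conjLocal_conjLocal_cm L v)) *
              halfModulusChar (UnitaryGroup.LocalRing L v))
            (torusLocalComponent L (IsCMField.complexConj L) v ξ.ψ)) k = 1) ∧
              (∀ k ∈ K₁, ((torusLocalComponent L (IsCMField.complexConj L) v ξ.ψ).comp (localDet (IsCMField.complexConj L) v (isUnit_antidiagOne_det L 1))) k = 1) then
          ((ν₁.real (K₁ : Set ((cmDatum L 1 (Matrix.of fun i j : Fin 1 => if i.val + j.val + 1 = 1 then (1 : L) else 0)).Local v)) : ℂ) * ((((torusLocalComponent L (IsCMField.complexConj L) v ξ.ψ).comp (localDet (IsCMField.complexConj L) v (isUnit_antidiagOne_det L 1))) z₁ : ℂˣ) : ℂ)) *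
            (((rootDeltaChar (cmBorelTriple L 2 v).P (Subgroup.inclusion (cmBorelTriple L 2 v).M_le ⟨b, hbM⟩) : ℂˣ) : ℂ) *
              ((((torusCharPair (conjLocal L (IsCMField.complexConj L) v) (cmLocalForm L 2 v) (cmLocalForm_eq_over L 2 v) 0
            ((torusLocalComponent L (IsCMField.complexConj L) v ξ.η).comp
                (quotConj (conjLocal L (IsCMField.complexConj L) v) (conjLocal_conjLocal_cm L v)) *
              halfModulusChar (UnitaryGroup.LocalRing L v))
            (torusLocalComponent L (IsCMField.complexConj L) v ξ.ψ)) ⟨b, hbM⟩ : ℂˣ) : ℂ) + (((weylTorusCharPair (conjLocal L (IsCMField.complexConj L) v) (cmLocalForm L 2 v) (cmLocalForm_eq_over L 2 v) 0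
            ((torusLocalComponent L (IsCMField.complexConj L) v ξ.η).comp
                (quotConj (conjLocal L (IsCMField.complexConj L) v) (conjLocal_conjLocal_cm L v)) *
              halfModulusChar (UnitaryGroup.LocalRing L v))
            (torusLocalComponent L (IsCMField.complexConj L) v ξ.ψ)) ⟨b, hbM⟩ : ℂˣ) : ℂ)))
        else 0) :=
    F0P3cStCharTSShellTracePSH.smoothTrace_cmPrincipalSeriesH_indicator_shell_eq_ite L v ν₂ ν₁ _ _ hψo 𝓘₂ n hbM hbN hbNbar hbexh hR₂ K₁ hK₁o hK₁c z₁
      hfd h2 ℓ hℓ1 _ hL hQ hiff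
  rw [e₁, if_pos ⟨hχlev, hK₁χ⟩]
  -- §3 the `χ_ξ`-term: `ξ_v` is constant on the shell (`K_H ≤ ker ξ_v`), the shell has measure `#R₂·ν₂(K_{2,n})·ν₁(K₁)`, and ★ p849803 kills the `wχ_H`-term
  have hK₁comm : ∀ k ∈ K₁, k * z₁ = z₁ * k := fun k _ => F0P3cStCharTSCassHTrace.subgroup_gl_one_mul_comm _ k z₁
  have hshell : (DoubleCoset.doubleCoset ((b, z₁) : ↥(unitaryGroupOfForm (conjLocal L (IsCMField.complexConj L) v) (cmLocalForm L 2 v)) × ((cmDatum L 1 (Matrix.of fun i j : Fin 1 => if i.val + j.val + 1 = 1 then (1 : L) else 0)).Local v)) (((𝓘₂.K n).prod K₁ : Subgroup (↥(unitaryGroupOfForm (conjLocal L (IsCMField.complexConj L) v) (cmLocalForm L 2 v)) × ((cmDatum L 1 (Matrix.of fun i j : Fin 1 => if i.val + j.val + 1 = 1 then (1 : L) else 0)).Local v))) : Set (↥(unitaryGroupOfForm (conjLocal L (IsCMField.complexConj L) v) (cmLocalForm L 2 v)) × ((cmDatum L 1 (Matrix.of fun i j : Fin 1 => if i.val + j.val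 + 1 = 1 then (1 : L) else 0)).Local v))) (((𝓘₂.K n).prod K₁ : Subgroup (↥(unitaryGroupOfForm (conjLocal L (IsCMField.complexConj L) v) (cmLocalForm L 2 v)) × ((cmDatum L 1 (Matrix.of fun i j : Fin 1 => if i.val + j.val + 1 = 1 then (1 : L) else 0)).Local v))) : Set (↥(unitaryGroupOfForm (conjLocal L (IsCMField.complexConj L) v) (cmLocalForm L 2 v)) × ((cmDatum L 1 (Matrix.of fun i j : Fin 1 => if i.val + j.val + 1 = 1 then (1 : L) else 0)).Local v)))) = (DoubleCoset.doubleCoset b (𝓘₂.K n : Set ↥(unitaryGroupOfForm (conjLocal L (IsCMField.complexConj L) v) (cmLocalForm L 2 v))) (𝓘₂.K n : Set ↥(unitaryGroupOfForm (conjLocal L (IsCMField.complexConj L) v) (cmLocalForm L 2 v)))) ×ˢ (z₁ • (K₁ : Set ((cmDatum L 1 (Matrix.of fun i j : Fin 1 => if i.val + j.val + 1 = 1 then (1 : L) else 0)).Local v))) := by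
    rw [doubleCoset_prod, doubleCoset_eq_smul_of_forall_comm K₁ hK₁comm]
  have hξconst : ∀ x ∈ (DoubleCoset.doubleCoset ((b, z₁) : ↥(unitaryGroupOfForm (conjLocal L (IsCMField.complexConj L) v) (cmLocalForm L 2 v)) × ((cmDatum L 1 (Matrix.of fun i j : Fin 1 => if i.val + j.val + 1 = 1 then (1 : L) else 0)).Local v)) (((𝓘₂.K n).prod K₁ : Subgroup (↥(unitaryGroupOfForm (conjLocal L (IsCMField.complexConj L) v) (cmLocalForm L 2 v)) × ((cmDatum L 1 (Matrix.of fun i j : Fin 1 => if i.val + j.val + 1 = 1 then (1 : L) else 0)).Local v))) : Set (↥(unitaryGroupOfForm (conjLocal L (IsCMField.complexConj L) v) (cmLocalForm L 2 v)) × ((cmDatum L 1 (Matrix.of fun i j : Fin 1 => if i.val + j.val + 1 = 1 then (1 : L) else 0)).Local v))) (((𝓘₂.K n).prod K₁ : Subgroup (↥(unitaryGroupOfForm (conjLocal L (IsCMField.complexConj L) v) (cmLocalForm L 2 v)) × ((cmDatum L 1 (Matrix.of fun i j : Fin 1 => if i.val + j.val + 1 = 1 then (1 : L) else 0)).Local v)))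 : Set (↥(unitaryGroupOfForm (conjLocal L (IsCMField.complexConj L) v) (cmLocalForm L 2 v)) × ((cmDatum L 1 (Matrix.of fun i j : Fin 1 => if i.val + j.val + 1 = 1 then (1 : L) else 0)).Local v)))), ξ.xiLocalChar v x = ξ.xiLocalChar v ((b, z₁) : ↥(unitaryGroupOfForm (conjLocal L (IsCMField.complexConj L) v) (cmLocalForm L 2 v)) × ((cmDatum L 1 (Matrix.of fun i j : Fin 1 => if i.val + j.val + 1 = 1 then (1 : L) else 0)).Local v)) :=
    fun x hx => apply_eq_of_mem_doubleCoset (ξ.xiLocalChar v) hlev hlev _ hx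
  -- `ν₂(K b K) = #R₂ · ν₂(K)` (§1, on the `U(Φ₂)` carrier) and the product measure of the shell
  have hKbK : ν₂.real (DoubleCoset.doubleCoset b (𝓘₂.K n : Set ↥(unitaryGroupOfForm (conjLocal L (IsCMField.complexConj L) v) (cmLocalForm L 2 v))) (𝓘₂.K n : Set ↥(unitaryGroupOfForm (conjLocal L (IsCMField.complexConj L) v) (cmLocalForm L 2 v)))) = (R₂.card : ℝ) * ν₂.real (𝓘₂.K n : Set ↥(unitaryGroupOfForm (conjLocal L (IsCMField.complexConj L) v) (cmLocalForm L 2 v))) :=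
    measureReal_doubleCoset_eq_card_mul (G := ↥(unitaryGroupOfForm (conjLocal L (IsCMField.complexConj L) v) (cmLocalForm L 2 v))) ν₂ (𝓘₂.isOpen_K n) b hR₂
  have hm : (ν₂.prod ν₁).real ((DoubleCoset.doubleCoset b (𝓘₂.K n : Set ↥(unitaryGroupOfForm (conjLocal L (IsCMField.complexConj L) v) (cmLocalForm L 2 v))) (𝓘₂.K n : Set ↥(unitaryGroupOfForm (conjLocal L (IsCMField.complexConj L) v) (cmLocalForm L 2 v)))) ×ˢ (z₁ • (K₁ : Set ((cmDatum L 1 (Matrix.of fun i j : Fin 1 => if i.val + j.val + 1 = 1 then (1 : L) else 0)).Local v)))) = (R₂.card : ℝ) * ν₂.real (𝓘₂.K n : Set ↥(unitaryGroupOfForm (conjLocal L (IsCMField.complexConj L) v) (cmLocalForm L 2 v))) * ν₁.real (K₁ : Set ((cmDatum L 1 (Matrix.of fun i j : Fin 1 => if i.val + j.val + 1 = 1 then (1 : L) else 0)).Local v)) := by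
    have hp := Measure.prod_prod (μ := ν₂) (ν := ν₁) (DoubleCoset.doubleCoset b (𝓘₂.K n : Set ↥(unitaryGroupOfForm (conjLocal L (IsCMField.complexConj L) v) (cmLocalForm L 2 v))) (𝓘₂.K n : Set ↥(unitaryGroupOfForm (conjLocal L (IsCMField.complexConj L) v) (cmLocalForm L 2 v)))) (z₁ • (K₁ : Set ((cmDatum L 1 (Matrix.of fun i j : Fin 1 => if i.val + j.val + 1 = 1 then (1 : L) else 0)).Local v)))
    rw [measure_smul_subgroup ν₁ K₁ z₁] at hp
    have hp' := congrArg ENNReal.toReal hp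
    rw [ENNReal.toReal_mul] at hp'
    have hA : (ν₂ (DoubleCoset.doubleCoset b (𝓘₂.K n : Set ↥(unitaryGroupOfForm (conjLocal L (IsCMField.complexConj L) v) (cmLocalForm L 2 v))) (𝓘₂.K n : Set ↥(unitaryGroupOfForm (conjLocal L (IsCMField.complexConj L) v) (cmLocalForm L 2 v))))).toReal = (R₂.card : ℝ) * ν₂.real (𝓘₂.K n : Set ↥(unitaryGroupOfForm (conjLocal L (IsCMField.complexConj L) v) (cmLocalForm L 2 v))) := hKbK
    rw [hA] at hp'
    exact hp'
  have hcd : charDist (ξ.xiLocalChar v) (ν₂.prod ν₁) (((DoubleCoset.doubleCoset ((b, z₁) : ↥(unitaryGroupOfForm (conjLocal L (IsCMField.complexConj L) v) (cmLocalForm L 2 v)) × ((cmDatum L 1 (Matrix.of fun i j : Fin 1 => if i.val + j.val + 1 = 1 then (1 : L) else 0)).Local v)) (((𝓘₂.K n).prod K₁ : Subgroup (↥(unitaryGroupOfForm (conjLocal L (IsCMField.complexConj L) v) (cmLocalForm L 2 v)) × ((cmDatum L 1 (Matrix.of fun i j : Fin 1 => if i.val + j.val + 1 = 1 then (1 : L)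 else 0)).Local v))) : Set (↥(unitaryGroupOfForm (conjLocal L (IsCMField.complexConj L) v) (cmLocalForm L 2 v)) × ((cmDatum L 1 (Matrix.of fun i j : Fin 1 => if i.val + j.val + 1 = 1 then (1 : L) else 0)).Local v))) (((𝓘₂.K n).prod K₁ : Subgroup (↥(unitaryGroupOfForm (conjLocal L (IsCMField.complexConj L) v) (cmLocalForm L 2 v)) × ((cmDatum L 1 (Matrix.of fun i j : Fin 1 => if i.val + j.val + 1 = 1 then (1 : L) else 0)).Local v))) : Set (↥(unitaryGroupOfForm (conjLocal L (IsCMField.complexConj L) v) (cmLocalForm L 2 v)) × ((cmDatum L 1 (Matrix.of fun i j : Fin 1 => if i.val + j.val + 1 = 1 then (1 : L) else 0)).Local v))))).indicator fun _ => (1 : ℂ)) =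
      (((R₂.card : ℝ) * ν₂.real (𝓘₂.K n : Set ↥(unitaryGroupOfForm (conjLocal L (IsCMField.complexConj L) v) (cmLocalForm L 2 v))) * ν₁.real (K₁ : Set ((cmDatum L 1 (Matrix.of fun i j : Fin 1 => if i.val + j.val + 1 = 1 then (1 : L) else 0)).Local v)) : ℝ) : ℂ) *
        ((ξ.xiLocalChar v ((b, z₁) : ↥(unitaryGroupOfForm (conjLocal L (IsCMField.complexConj L) v) (cmLocalForm L 2 v)) × ((cmDatum L 1 (Matrix.of fun i j : Fin 1 => if i.val + j.val + 1 = 1 then (1 : L) else 0)).Local v)) : ℂˣ) : ℂ) := by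
    have h := charDist_indicator_of_forall_eq (ν₂.prod ν₁) (ξ.xiLocalChar v) hSo.measurableSet hξconst
    have hmS := congrArg (fun T : Set (↥(unitaryGroupOfForm (conjLocal L (IsCMField.complexConj L) v) (cmLocalForm L 2 v)) × ((cmDatum L 1 (Matrix.of fun i j : Fin 1 => if i.val + j.val + 1 = 1 then (1 : L) else 0)).Local v)) => (ν₂.prod ν₁).real T) hshell
    rw [hmS, hm] at h
    exact h
  rw [hcd, F0P3cStCharTSXiOnTorus.xiLocalChar_eq_psi_mul_rootDeltaChar_mul_weyl L v ξ b hbM z₁]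
  push_cast
  ring

end CM

end Summit.HodgeConjecture.HodgeConjecture.Cruxes.H413.F0P3cStCharTSStShellTrace

end
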